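import Mathlib
import Summits.Schanuel.Schanuel.Theses.RigidCore
import Literature.NumberTheory.Transcendental.GammaFields
import Literature.NumberTheory.Transcendental.GammaIsoTransfer
import Literature.NumberTheory.Transcendental.ZilberFieldExistenceProofs
import Summits.Schanuel.Schanuel.Theorems.MinimalCounterexampleInAcl.Negative.LocusMates

/-!
# Crux `RigidCore.MinimalCounterexampleInAcl` (stmt-Schanuel-0969), line `span-growth-dichotomy`:
registered stub T2 `stub_spanGrowthStep` — the span-growth step (lead c17)

The registered stub T2 of the skeleton `Cruxes/MinimalCounterexampleInAcl/Lines/span-growth-dichotomy.lean`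
is stated VERBATIM and proved: if Schanuel's conjecture holds in every rank `r < n`, `x' ∈ ℂⁿ` is
ℚ-linearly independent with predimension `δ(span_ℚ x') ≤ −1`, and `x'` is not contained in a finitely
generated ℚ-subspace `S ≤ ℂ`, then `δ(S + span_ℚ x') ≤ δ(S) − 1` ("a new mate costs one unit of
predimension").

Proof (Bays–Kirby 2018, Lemma 4.2): with `U = span_ℚ x'`,

* `δ(S ⊔ U / 0) = δ(S / 0) + δ(S ⊔ U / S)` (addition formula `GammaField.predim_add`);
* `δ(S ⊔ U / S) ≤ δ(U / U ⊓ S)` (submodularity `GammaField.predim_sup_le`);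
* `δ(U / 0) = δ(U ⊓ S / 0) + δ(U / U ⊓ S)` (addition formula again), and `δ(U / 0) ≤ −1`;
* `0 ≤ δ(U ⊓ S / 0)`: `U ⊓ S` is a PROPER subspace of the `n`-dimensional `U` (as `range x' ⊄ S`),
  so it has a ℚ-basis `v : Fin r → ℂ` with `r < n`, and `SchanuelRank r` applied to `v` gives
  `r ≤ trdeg ℚ(v, eᵛ)`, i.e. `0 ≤ δ(span_ℚ v / 0)` along the landed bridge
  `Negative.predim_bot_span_range` / `Negative.natCast_le_trdeg_iff`.

Main statement: `stub_spanGrowthStep`; helpers `predim_bot_span_nonneg_of_schanuelRank`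
(Schanuel in rank `r` is `δ ≥ 0` on ℚ-linearly independent `r`-tuples) and
`predim_bot_nonneg_of_lt_span` (Schanuel below `n` is `δ ≥ 0` on proper subspaces of the span of a
ℚ-linearly independent `n`-tuple).

## References

* M. Bays, J. Kirby, *Pseudo-exponential maps, variants, and quasiminimality*, Algebra & Number Theory
  12 (2018), arXiv:1512.04262, Def. 4.1 / Lemma 4.2 (predimension `δ`, addition formula, submodularity).
-/

noncomputable section

set_option linter.dupNamespace false

open Complex Set
open Literature.NumberTheory.Transcendental
open Literature.NumberTheory.Transcendental.GammaField
open Summit.Schanuel.Schanuel.Theorems.MinimalCounterexampleInAcl.Negative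

namespace Summit.Schanuel.Schanuel.Cruxes.MinimalCounterexampleInAcl.SpanGrowthDichotomy

/-- **Schanuel in rank `r` is `δ ≥ 0` on ℚ-linearly independent `r`-tuples**: if `SchanuelRank r`
holds and `v : Fin r → ℂ` is ℚ-linearly independent then `0 ≤ δ(span_ℚ v / 0)`
(`r ≤ trdeg ℚ(v, eᵛ) = rk(v ∪ eᵛ)` and `δ(span_ℚ v / 0) = rk(v ∪ eᵛ) − r`).
[cite: BaysKirby2018ANT, §9.1] -/
theorem predim_bot_span_nonneg_of_schanuelRank {r : ℕ} (hr : SchanuelRank r) {v : Fin r → ℂ}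
    (hv : LinearIndependent ℚ v) :
    0 ≤ predim (⊥ : Submodule ℚ ℂ) (Submodule.span ℚ (range v)) := by
  have h : (r : ℕ∞) ≤ (algMatroid ℂ).eRk (range v ∪ range (cexp ∘ v)) :=
    (natCast_le_trdeg_iff v r).1 (hr v hv)
  rw [predim_bot_span_range hv]
  rw [← ENat.coe_toNat (eRk_range_ne_top v)] at h
  have h' : r ≤ ((algMatroid ℂ).eRk (range v ∪ range (cexp ∘ v))).toNat := by exact_mod_cast h
  omega

/-- **Schanuel below `n` is `δ ≥ 0` on proper subspaces of the span of a ℚ-linearly independent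
`n`-tuple**: if `SchanuelRank r` holds for every `r < n`, `x' : Fin n → ℂ` is ℚ-linearly independent
and `W < span_ℚ x'` is a proper ℚ-subspace, then `0 ≤ δ(W / 0)` (pick a ℚ-basis `v : Fin r → ℂ` of
`W`; `r = dim W < dim span_ℚ x' = n`). [cite: BaysKirby2018ANT, §9.1] -/
theorem predim_bot_nonneg_of_lt_span {n : ℕ} (hrank : ∀ r < n, SchanuelRank r) {x' : Fin n → ℂ}
    (hli : LinearIndependent ℚ x') {W : Submodule ℚ ℂ} (hW : W < Submodule.span ℚ (range x')) :
    0 ≤ predim (⊥ : Submodule ℚ ℂ) W := by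
  haveI : FiniteDimensional ℚ ↥(Submodule.span ℚ (range x')) :=
    FiniteDimensional.span_of_finite ℚ (finite_range x')
  haveI : FiniteDimensional ℚ ↥W := Submodule.finiteDimensional_of_le hW.le
  have hfin : Module.finrank ℚ ↥W < n := by
    have h := Submodule.finrank_lt_finrank_of_lt hW
    rwa [finrank_span_eq_card hli, Fintype.card_fin] at h
  -- a ℚ-basis of `W`, viewed in `ℂ`
  set b := Module.finBasis ℚ ↥W with hb
  have hv : LinearIndependent ℚ (W.subtype ∘ b) := b.linearIndependent.map' W.subtype W.ker_subtype
  have hspan : Submodule.span ℚ (range (W.subtype ∘ b)) = W := by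
    rw [range_comp, Submodule.span_image, b.span_eq, Submodule.map_subtype_top]
  rw [← hspan]
  exact predim_bot_span_nonneg_of_schanuelRank (hrank _ hfin) hv

/-- **Stub T2 (registered, verbatim) — the span-growth step.** If Schanuel holds in all ranks `< n`,
`x' ∈ ℂⁿ` is ℚ-linearly independent with `δ(span_ℚ x') ≤ −1`, and `x'` is not inside the finitely
generated ℚ-space `S`, then `δ(S + span_ℚ x') ≤ δ(S) − 1`: with `U = span_ℚ x'`,
`δ(S ⊔ U/0) − δ(S/0) = δ(S ⊔ U/S) ≤ δ(U/U ⊓ S) = δ(U/0) − δ(U ⊓ S/0) ≤ −1 − 0`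
(`predim_add` twice, `predim_sup_le`, and `predim_bot_nonneg_of_lt_span` for the proper subspace
`U ⊓ S < U`). [cite: BaysKirby2018ANT, Lemma 4.2] -/
theorem stub_spanGrowthStep :
    ∀ {n : ℕ}, (∀ r < n, Literature.NumberTheory.Transcendental.SchanuelRank r) →
      ∀ {x' : Fin n → ℂ}, LinearIndependent ℚ x' →
        Literature.NumberTheory.Transcendental.GammaField.predim (⊥ : Submodule ℚ ℂ)
            (Submodule.span ℚ (Set.range x')) ≤ -1 →
        ∀ S : Submodule ℚ ℂ, S.FG → ¬ (Set.range x' ⊆ (S : Set ℂ)) →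
          Literature.NumberTheory.Transcendental.GammaField.predim (⊥ : Submodule ℚ ℂ)
              (S ⊔ Submodule.span ℚ (Set.range x')) ≤
            Literature.NumberTheory.Transcendental.GammaField.predim (⊥ : Submodule ℚ ℂ) S - 1 := by
  intro n hrank x' hli hδ S hS hnew
  set U : Submodule ℚ ℂ := Submodule.span ℚ (Set.range x') with hU
  -- finite generation of the extensions involved
  have hUfg : IsFG (⊥ : Submodule ℚ ℂ) U := isFG_span_of_finite _ (finite_range x')
  have hSfg : IsFG (⊥ : Submodule ℚ ℂ) S := hS.map _
  have hSUfg : IsFG (⊥ : Submodule ℚ ℂ) (S ⊔ U) := hSfg.sup hUfg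
  have hUSfg : IsFG (U ⊓ S) U := isFG_span_of_finite _ (finite_range x')
  -- (1) addition formula along `⊥ ≤ S ≤ S ⊔ U`
  have h1 : predim (⊥ : Submodule ℚ ℂ) (S ⊔ U) = predim (⊥ : Submodule ℚ ℂ) S + predim S (S ⊔ U) :=
    predim_add bot_le le_sup_left hSUfg
  -- (2) submodularity
  have h2 : predim S (S ⊔ U) ≤ predim (U ⊓ S) U := by
    rw [predim_sup_left, ← predim_sup_right]
    exact predim_sup_le U S hUSfg
  -- (3) addition formula along `⊥ ≤ U ⊓ S ≤ U`
  have h3 : predim (⊥ : Submodule ℚ ℂ) U =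
      predim (⊥ : Submodule ℚ ℂ) (U ⊓ S) + predim (U ⊓ S) U :=
    predim_add bot_le inf_le_left hUfg
  -- (4) `U ⊓ S` is a proper subspace of `U`, so Schanuel below `n` gives `0 ≤ δ(U ⊓ S / 0)`
  have hlt : U ⊓ S < U := by
    refine lt_of_le_of_ne inf_le_left fun h => hnew ?_
    have hUS : U ≤ S := by rw [← h]; exact inf_le_right
    exact Submodule.subset_span.trans hUS
  have h4 : 0 ≤ predim (⊥ : Submodule ℚ ℂ) (U ⊓ S) := predim_bot_nonneg_of_lt_span hrank hli hlt
  -- combine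
  linarith

end Summit.Schanuel.Schanuel.Cruxes.MinimalCounterexampleInAcl.SpanGrowthDichotomy

end
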